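import Summits.CriticalPhenomena.PercolationContinuityZ3.Theses.PercLowPointHalfSpace
import Summits.CriticalPhenomena.PercolationContinuityZ3.Theorems.PercLowPointHalfSpaceQuantitativeBGNArmToSurfaceTail
import Summits.CriticalPhenomena.PercolationContinuityZ3.Theorems.PercLowPointHalfSpaceQuantitativeBGNKlSurfaceTail
import Literature.Probability.Percolation.CriticalContinuityProofs
import HarnessLib

/-!
# Crux `PercLowPointHalfSpace.QuantitativeBGN` (stmt-CriticalPhenomena-0913), line
# `kl-surface-susceptibility-transfer` — the transfer: `γ₁ < 2 ⇒ QuantitativeBGN`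

Lead prover's file for the crux skeleton `Cruxes/QuantitativeBGN/Lines/kl-surface-susceptibility-transfer.lean`
(line lead prover-line-stmt-CriticalPhenomena-0913-0); lands with `--supports stmt-CriticalPhenomena-0913`.
With the two landed stubs `stub_armToSurfaceTail` (ambient arm event ≤ induced cluster-size tail,
p77770) and `stub_klSurfaceTail` (Hutchcroft's KL lemma on the half-space graph + Markov, p79950),
the composition of the line is sorry-free MODULO its single open stub `stub_surfaceGammaSubQuadratic`
(`γ₁ < 2`: a sub-quadratic power law for the SUBCRITICAL surface susceptibility). This file records
that composition as unconditional implications whose hypotheses are the open stub, stated verbatim,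
and whose conclusion is the crux decl BY NAME:

* `QuantitativeBGNKlTransfer.binaryKL_le_sq_div` — chi-square bound `kl(a‖b) ≤ (a−b)²/(b(1−b))`.
* `QuantitativeBGNKlTransfer.real_clusterSizeGe_criticalProb_le` — STUB 2 + (γ, C, δ as in STUB 3)
  ⇒ `P^H_{p_c}(|C_H(o)| ≥ n) ≤ K n^{-(1−γ/2)}` for every `n ≥ 1` (scale choice `ε = ε₀ n^{-1/2}`,
  `ε₀ = min(δ, p_c)/2`; the only place where `p = p_c` is used, as the second parameter of STUB 2).
* `quantitativeBGN_of_surfaceVolumeTail` — ANY polynomial volume tail for the critical half-space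
  cluster on the induced graph gives the crux, same exponent (through STUB 1 alone).
* `quantitativeBGN_of_surfaceGammaSubQuadratic` — **`γ₁ < 2 ⇒ QuantitativeBGN`** with
  `a = 1 − γ₁/2`: the surface analogue of the bulk halving "`γ < 2 ⇒ θ(p_c) = 0`"
  (Dewan–Muirhead 2023 Rem. 1.11 / Hutchcroft 2022 Thm 1.3; barrier file
  `Literature/Barriers/CriticalPhenomena/SubexponentialGrowthZdNarrow.lean`).

The hypothesis of the last theorem is OPEN (no near-critical power-law upper bound on any percolation
susceptibility is known for `3 ≤ d ≤ 6`; numerically `γ₁ = ν(3 − x_s − x_b) ≈ 1.36` in `d = 3`,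
Deng–Blöte 2005); it is the registered stub `stub_surfaceGammaSubQuadratic` of the skeleton and is
stated here verbatim, not as a named fact. No new definitions.
-/

noncomputable section

namespace Summit.CriticalPhenomena.PercolationContinuityZ3.Theorems

open MeasureTheory Filter
open Literature.Probability.Percolation Literature.Probability.LatticeModels Literature.Probability.Entropy
open scoped ENNReal Topology

namespace QuantitativeBGNKlTransfer

/-- **Chi-square upper bound on the binary relative entropy**: `kl(a‖b) ≤ (a−b)²/(b(1−b))` for
`a ∈ [0,1]`, `b ∈ (0,1)` (termwise `log x ≤ x − 1`). This is the KL price of the comparison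
`p = p_c − ε` versus `p_c`: `≤ ε²/(p_c(1−p_c))`. [folklore] -/
theorem binaryKL_le_sq_div {a b : ℝ} (ha0 : 0 ≤ a) (ha1 : a ≤ 1) (hb0 : 0 < b) (hb1 : b < 1) :
    binaryKL a b ≤ (a - b) ^ 2 / (b * (1 - b)) := by
  have h1b : 0 < 1 - b := by linarith
  have t1 : a * Real.log (a / b) ≤ a * (a / b - 1) := by
    rcases ha0.eq_or_lt with h | ha
    · rw [← h]; simp
    · exact mul_le_mul_of_nonneg_left (Real.log_le_sub_one_of_pos (div_pos ha hb0)) ha.le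
  have t2 : (1 - a) * Real.log ((1 - a) / (1 - b)) ≤ (1 - a) * ((1 - a) / (1 - b) - 1) := by
    rcases (sub_nonneg.2 ha1).eq_or_lt with h | h
    · rw [← h]; simp
    · exact mul_le_mul_of_nonneg_left (Real.log_le_sub_one_of_pos (div_pos h h1b)) h.le
  calc binaryKL a b = a * Real.log (a / b) + (1 - a) * Real.log ((1 - a) / (1 - b)) := rfl
    _ ≤ a * (a / b - 1) + (1 - a) * ((1 - a) / (1 - b) - 1) := add_le_add t1 t2
    _ = (a - b) ^ 2 / (b * (1 - b)) := by field_simp; ring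

/-- **STUB 2 + a sub-quadratic surface susceptibility ⇒ a polynomial volume tail AT `p_c` on `H`.**
If `χ_H(p) ≤ C (p_c − p)^{-γ}` for `p ∈ (p_c − δ, p_c)` (`C, δ > 0`), then for every `n ≥ 1`,
`P^H_{p_c}(|C_H(o)| ≥ n) ≤ K n^{-(1 − γ/2)}` with `K = C ε₀^{-γ}(2 + 48 ε₀²/(p_c(1−p_c)))`,
`ε₀ = min(δ, p_c)/2`: apply `stub_klSurfaceTail` at `(p, q) = (p_c − ε, p_c)`, `ε = ε₀ n^{-1/2}`,
`M = C ε^{-γ}`, and `kl(p_c − ε ‖ p_c) ≤ ε²/(p_c(1−p_c))`. Uses `0 < p_c(ℤ³) < 1`. [folklore] -/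
theorem real_clusterSizeGe_criticalProb_le {γ C δ : ℝ} (hC : 0 < C) (hδ : 0 < δ)
    (hS : ∀ p : unitInterval, criticalProb (zdGraph 3) (0 : Site 3) - δ < p →
      (p : ℝ) < criticalProb (zdGraph 3) (0 : Site 3) →
        expClusterSize (halfSpaceGraph 3) (halfSpaceOrigin 3) p ≤
          ENNReal.ofReal (C * (criticalProb (zdGraph 3) (0 : Site 3) - p) ^ (-γ))) :
    ∃ K : ℝ, ∀ n : ℕ, 1 ≤ n →
      (bondPercolation (halfSpaceGraph 3) (criticalProbI 3)).real (clusterSizeGe (halfSpaceOrigin 3) n) ≤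
        K * (n : ℝ) ^ (-(1 - γ / 2)) := by
  set pc : ℝ := criticalProb (zdGraph 3) (0 : Site 3) with hpc_def
  have hpc0 : 0 < pc := criticalProb_zd_pos 3 (by norm_num)
  have hpc1 : pc < 1 := criticalProb_zd_lt_one (d := 3) (by norm_num)
  -- the scale-free part `ε₀` of `ε = ε₀ n^{-1/2}`: small enough for every `n ≥ 1`
  set ε₀ : ℝ := min δ pc / 2 with hε₀_def
  have hε₀pos : 0 < ε₀ := by
    have : 0 < min δ pc := lt_min hδ hpc0
    rw [hε₀_def]; linarith
  have hε₀δ : ε₀ < δ := by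
    have : min δ pc ≤ δ := min_le_left _ _
    rw [hε₀_def]; linarith
  have hε₀pc : ε₀ ≤ pc / 2 := by
    have : min δ pc ≤ pc := min_le_right _ _
    rw [hε₀_def]; linarith
  refine ⟨C * ε₀ ^ (-γ) * (2 + 48 * (ε₀ ^ 2 / (pc * (1 - pc)))), fun n hn => ?_⟩
  have hn0 : (0 : ℝ) < n := by exact_mod_cast hn
  have hn1 : (1 : ℝ) ≤ n := by exact_mod_cast hn
  -- the scale `s = n^{-1/2} ∈ (0, 1]`
  set s : ℝ := (n : ℝ) ^ (-(1 / 2 : ℝ)) with hs_def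
  have hs0 : 0 < s := Real.rpow_pos_of_pos hn0 _
  have hs1 : s ≤ 1 := Real.rpow_le_one_of_one_le_of_nonpos hn1 (by norm_num)
  have hs2 : s ^ 2 = (n : ℝ)⁻¹ := by
    rw [hs_def, ← Real.rpow_natCast ((n : ℝ) ^ (-(1 / 2 : ℝ))) 2, ← Real.rpow_mul hn0.le,
      ← Real.rpow_neg_one]
    congr 1
    norm_num
  have e2 : s ^ (-γ) * s ^ 2 = (n : ℝ) ^ (-(1 - γ / 2)) := by
    rw [hs_def, ← Real.rpow_mul hn0.le, ← Real.rpow_natCast ((n : ℝ) ^ (-(1 / 2 : ℝ))) 2,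
      ← Real.rpow_mul hn0.le, ← Real.rpow_add hn0]
    congr 1
    push_cast
    ring
  -- `ε = ε₀ s` and the subcritical parameter `p = p_c - ε`
  set ε : ℝ := ε₀ * s with hε_def
  have hε0 : 0 < ε := mul_pos hε₀pos hs0
  have hεle : ε ≤ ε₀ := by rw [hε_def]; exact mul_le_of_le_one_right hε₀pos.le hs1
  have hp0 : 0 < pc - ε := by linarith
  have hp1 : pc - ε < 1 := by linarith
  set p : unitInterval := ⟨pc - ε, hp0.le, hp1.le⟩ with hp_def
  have hpcoe : (p : ℝ) = pc - ε := rfl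
  -- the susceptibility hypothesis at `p`
  have hSp := hS p (by rw [hpcoe]; linarith) (by rw [hpcoe]; linarith)
  have hpe : pc - (p : ℝ) = ε := by rw [hpcoe]; ring
  rw [hpe] at hSp
  have hM0 : 0 ≤ C * ε ^ (-γ) := (mul_pos hC (Real.rpow_pos_of_pos hε0 _)).le
  -- STUB 2 at `(p, p_c)` with `M = C ε^{-γ}`
  have hq0 : 0 < ((criticalProbI 3 : unitInterval) : ℝ) := hpc0
  have hq1 : ((criticalProbI 3 : unitInterval) : ℝ) < 1 := hpc1
  have hK2 := stub_klSurfaceTail p (criticalProbI 3) (by rw [hpcoe]; exact hp0)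
    (by rw [hpcoe]; exact hp1) hq0 hq1 (C * ε ^ (-γ)) hM0 hSp n hn
  -- the chi-square bound on the KL price: `kl(p ‖ p_c) ≤ ε² / (p_c (1 - p_c))`
  have hkl : binaryKL (p : ℝ) ((criticalProbI 3 : unitInterval) : ℝ) ≤ ε ^ 2 / (pc * (1 - pc)) := by
    have h := binaryKL_le_sq_div (a := pc - ε) (b := pc) hp0.le hp1.le hpc0 hpc1
    have e : (pc - ε - pc) ^ 2 = ε ^ 2 := by ring
    rw [e] at h
    exact h
  -- assemble
  calc (bondPercolation (halfSpaceGraph 3) (criticalProbI 3)).real (clusterSizeGe (halfSpaceOrigin 3) n)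
      ≤ C * ε ^ (-γ) * (2 / (n : ℝ) + 48 * binaryKL (p : ℝ) ((criticalProbI 3 : unitInterval) : ℝ)) :=
        hK2
    _ ≤ C * ε ^ (-γ) * (2 / (n : ℝ) + 48 * (ε ^ 2 / (pc * (1 - pc)))) :=
        mul_le_mul_of_nonneg_left
          (add_le_add le_rfl (mul_le_mul_of_nonneg_left hkl (by norm_num : (0 : ℝ) ≤ 48))) hM0
    _ = C * ε₀ ^ (-γ) * (2 + 48 * (ε₀ ^ 2 / (pc * (1 - pc)))) * (n : ℝ) ^ (-(1 - γ / 2)) := by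
        rw [← e2, hε_def, Real.mul_rpow hε₀pos.le hs0.le, div_eq_mul_inv (2 : ℝ) (n : ℝ), ← hs2]
        ring

end QuantitativeBGNKlTransfer

/-- **Any polynomial volume tail for the critical half-space cluster (on the induced graph) gives the
crux**, with the same exponent: `P^{ℤ³}_{p_c}(arm_H(0,r)) ≤ P^H_{p_c}(|C_H(o)| ≥ r) ≤ C r^{-b}` by the
landed bridge `stub_armToSurfaceTail`. [folklore] -/
theorem quantitativeBGN_of_surfaceVolumeTail
    (h : ∃ b C : ℝ, 0 < b ∧ ∀ n : ℕ, 1 ≤ n →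
      (bondPercolation (halfSpaceGraph 3) (criticalProbI 3)).real (clusterSizeGe (halfSpaceOrigin 3) n) ≤
        C * (n : ℝ) ^ (-b)) :
    Summit.CriticalPhenomena.PercolationContinuityZ3.Theses.PercLowPointHalfSpace.QuantitativeBGN := by
  obtain ⟨b, C, hb, hC⟩ := h
  exact ⟨b, C, hb, fun r hr => (stub_armToSurfaceTail (criticalProbI 3) r).trans (hC r hr)⟩

/-- **`γ₁ < 2 ⇒ QuantitativeBGN`** (the transfer of line `kl-surface-susceptibility-transfer`): if the
surface susceptibility `χ_H(p) = expClusterSize (halfSpaceGraph 3) (halfSpaceOrigin 3) p` of `ℤ³` bond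
percolation obeys `χ_H(p) ≤ C (p_c − p)^{-γ}` on a left neighbourhood `(p_c − δ, p_c)` of `p_c(ℤ³)` with
`γ < 2`, then the boundary one-arm probability at `p_c` decays polynomially, with exponent
`a = 1 − γ/2 > 0`. The hypothesis is the (open) registered stub `stub_surfaceGammaSubQuadratic`,
verbatim (fully qualified: this implication is itself the registered sub-goal
`quantitativeBGN_of_surfaceGammaSubQuadratic` of stmt-CriticalPhenomena-0913, matched textually); the
proof is STUB 1 ∘ (STUB 2 + chi-square KL bound + `ε = ε₀ r^{-1/2}`).
[cite: Hutchcroft2022Triangle, Thm. 1.3 (the KL lemma; surface transfer is this file's)] -/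
theorem quantitativeBGN_of_surfaceGammaSubQuadratic :
    (∃ γ C δ : ℝ, γ < 2 ∧ 0 < C ∧ 0 < δ ∧ ∀ p : unitInterval,
      Literature.Probability.Percolation.criticalProb (Literature.Probability.LatticeModels.zdGraph
      3) (0 : Literature.Probability.LatticeModels.Site 3) - δ < p → (p : ℝ) <
      Literature.Probability.Percolation.criticalProb (Literature.Probability.LatticeModels.zdGraph
      3) (0 : Literature.Probability.LatticeModels.Site 3) →
      Literature.Probability.Percolation.expClusterSize
      (Literature.Probability.Percolation.halfSpaceGraph 3)
      (Literature.Probability.Percolation.halfSpaceOrigin 3) p ≤ ENNReal.ofReal (C *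
      (Literature.Probability.Percolation.criticalProb (Literature.Probability.LatticeModels.zdGraph
      3) (0 : Literature.Probability.LatticeModels.Site 3) - p) ^ (-γ))) →
      Summit.CriticalPhenomena.PercolationContinuityZ3.Theses.PercLowPointHalfSpace.QuantitativeBGN := by
  rintro ⟨γ, C, δ, hγ, hC, hδ, hS⟩
  obtain ⟨K, hK⟩ := QuantitativeBGNKlTransfer.real_clusterSizeGe_criticalProb_le (γ := γ) hC hδ hS
  exact quantitativeBGN_of_surfaceVolumeTail ⟨1 - γ / 2, K, by linarith, hK⟩

end Summit.CriticalPhenomena.PercolationContinuityZ3.Theorems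

end
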